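/-
COR-CM (cell pub-hodgecm2, stage 2 of the Hodge ladder) — TRANSPOSITION SURGE, item (vi) sub-binder S2 / (vi-2) `supply`: the AS-PRINTED
junction (coordinator rulings 2026-08-21T13:05:07Z «STATEMENT-EXACT TYPINGS … THEN REWIRE» and 15:33:56Z (2); hodge-director/ITEM6-SPLIT.md
§5).  Seat prover-pub-hodgecm2-item6-p1-0.  Theorems only: no definition, no named fact, no `sorry`, nothing asserted.  Consumes BY NAME the
as-printed typing `Literature.NumberTheory.Automorphic.Liu2021.Thm418AsPrinted` (lit-liu-asprinted, p277833 ✔), item6-p3's bookkeeping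
consequences `Liu2021/Thm418Invariants.lean`, and the S2 socket `Transposition/Item6SupplyReach.lean` (p278665 ✔).  FRAMING: HC_CM is NOT
proved; this file discharges NO object-match binder — it makes the undischarged binders kernel-exact.
GUARDS (RULING «AS-PRINTED JUNCTION T1», pub-hodgecm2 lead gen 6, HOME/INBOX l.4000): every binder is demanded only under the face scope
`IsGalois ℚ F → 6 ≤ finrank ℚ F → ι₁ ∈ Φ` (the unguarded draft 2c4b4a39d55e was refuted by htheta-x2 g2 at `ℚ(ζ₄)`/isotropic form, where
`U_rec` realises `ℙ²`: `X2S2T1.junction_hypotheses_inconsistent`; never filed).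
T1 / T5 CONSISTENCY (ruling l.4000 (2)(a)(b); coordinator ruling 15:33:56Z (3)): (a) the five binder TYPES below are CHARACTER-FOR-
CHARACTER htheta-x2's probe predicates `X2S2T1.HLiuG/HObjG/HChiG/HOmegaG/HMatchG` (`pub-hodgecm-own-htheta/x2/probes/probe_x2_s2junction_t1
.lean` md5 6ccb0effb6b4; `x2/tools/bindertext_diff_v3.py` against this file: 5/5 «equal: True»), so x2's kernel results apply verbatim: the
`ℚ(ζ₄)`/`ℙ²` refutation route is STUCK at `⊢ 6 ≤ Module.finrank ℚ F₀.K` (= 6 ≤ 2, `X2S2T1.not_six_le_finrank_F₀` :1574) — it does NOT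
close `False` against the guarded family — and `X2S2T1.exists_rescoped'_iff_socketReach` :1564 gives «(∃ D, five guarded binders) ↔
SocketReach»; (b) IN-KERNEL RELATIVE CERTIFICATE in this file, `Model.exists_thm418Binders_iff_faceSupply`: «∃ D, hLiu ∧ hObj ∧ hChi ∧ hω ∧
hMatch» ↔ B01-S `U.FaceSupply`, the Liu-side four being jointly INHABITED outright at item6-p3's scalar datum
(`Liu2021.Thm418Data.scalarDatum_consistent`) — so no contradiction is derivable from the family unless B01-S itself is refutable.
STRENGTH (RULING l.4000 (3), said in those words): with the datum family `D` FREE the binder family is ↔ B01-S — the cite binder is IDLE at a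
scalar datum and `hMatch` = the Albanese-reach statement itself; the junction certifies SCOPE (every printed hypothesis of Thm. 4.18 met at
every face), not SUPPLY; supply = the object match until `D` is PINNED to Liu's theta data (own-htheta `Transposition/Item6SupplyPinned.lean`,
ITEM6-SPLIT (vi-0)).
-/
import Literature.NumberTheory.Automorphic.Liu2021.Thm418Invariants
import Summits.HodgeConjecture.CorCM.B01.Transposition.Item6SupplyReach
import HarnessLib

/-!
# Item (vi) S2 from [Liu2021, Thm. 4.18] AS PRINTED — the face-guarded junction, with every non-printed binder explicit, and its
# strength/consistency certificate

For the universe of record `U = Model.picardCMUniverse hHD hI h₁ h₃` and, per face context `(F, ι₁, V)` and CM type `Φ`, a consumer-supplied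
datum `D F ι₁ V Φ : Thm418Data F⁺ F` of [Liu2021] §4.2 (REAL `F⁺ ⊂ F`, REAL weight-one conjugate-symplectic `μ`; carriers `G`, `ω(μ,ε,χ)`,
`𝒜(μ)`, `Ω(μ)`, `Hom_E(A_K, A_μ)_ℚ`):

* §1 `Model.faceSupply_of_thm418AsPrinted` — face-guarded `hLiu` (Thm. 4.18 AS PRINTED) + `hObj` + `hChi` + `hω` + `hMatch` ⟹ B01-S
  `U.FaceSupply`; `Model.exists_supplyWitness_of_thm418AsPrinted` — the same ⟹ the supply clause of item (vi) in the ∃ι₁ ∃V form (S2-∃).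
* §2 `Model.exists_albaneseHom_ne_zero_of_faceSupply` (B01-S ⟹ the object match's conclusion, for every datum) and the certificate
  `Model.exists_thm418Binders_iff_faceSupply` : (∃ D, all five guarded binders) ↔ `U.FaceSupply`.
* §3 `Model.faceSupply_closed_of_thm418AsPrinted` — the universe OF RECORD.

THE BINDER LIST beyond the cite binder `hLiu` is the finding asked for by the rulings («if the derivation FAILS, record EXACTLY which printed
hypothesis is not met at a general face»): NONE of Thm. 4.18's printed hypotheses fails at a face; what remains is `hObj` ([Liu2021] Prop. 4.6
(1), `FJcycle.tex` l. 1969: `𝒜(μ) ≠ ∅` — printed in the paper, not in Thm. 4.18), `hChi` (one automorphic character of `E¹\(𝔸_E^∞)¹`, Def.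
4.11 l. 2090 — the trivial one), `hω` (Def. 4.11 «irreducible admissible» l. 2094–2096 with App. D Lem. D.1 (1) l. 5226–5229 — printed in the
paper, not in Thm. 4.18; carrier-level here), and `hMatch` — THE OBJECT MATCH (ITEM6-SPLIT §5 U1–U3; C0/C6a/C6b* of
`transposition/item-6/p1/S2-ASPRINTED-CHAIN.md`): «a non-zero element of `Hom_E(A_K, A_μ)_ℚ` at an open compact `K` yields a non-zero
homomorphism `Alb(P_Γ(V)) → A_{(F,Φ)}` for some level `Γ` of the tree's `V`-tower» — neither printed nor a tree theorem; uniform in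
`[F:ℚ] ≥ 6` and in the face.  Everything else is kernel: the `μ`-admissible `ε` (Def. 4.12) EXISTS (`Liu2021.exists_isAdmissibleElement_of_cmType`),
Thm. 4.18 (main) + (1) ⟹ `Hom_E(A_K, A_μ)_ℚ ≠ 0` at some open compact `K` (`Liu2021.Thm418Data.exists_level_homK_ne_zero`, item6-p3),
isotypicity and level joining (`Item6SupplyReach`).  No hypothesis on the degree or the face enters; nothing is sextic.  [GR91 Prop. 3.1.1]
(`GelbartRogawski1991.Prop311AsPrinted`) is IDLE on this saturated-theta-set path and is therefore not a binder here.
-/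

noncomputable section

namespace Summit.HodgeConjecture.CorCM.Model

open CategoryTheory AlgebraicGeometry NumberField
open Literature.AlgebraicGeometry.Motives
open Literature.AlgebraicGeometry.HodgeTheory
open Literature.NumberTheory.Automorphic.PicardCM
open Literature.NumberTheory.Automorphic.Liu2021

/-! ## §1  The junction: Thm. 4.18 AS PRINTED + the face-guarded non-printed binders ⟹ B01-S ⟹ (S2-∃) -/

/-- **S2 FROM [Liu2021, Thm. 4.18] AS PRINTED — every non-printed binder explicit and FACE-GUARDED** (`U = picardCMUniverse
hHD hI h₁ h₃`).  For every face context — `F` Galois CM with `6 ≤ [F:ℚ]`, a CM type `Φ ∋ ι₁`, `V : HermSpace3 F ι₁` — the consumer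
supplies ITS OWN datum `D F ι₁ V Φ : Thm418Data F⁺ F` of [Liu2021] §4.2 (Liu's `E := F`, `F := F⁺`; intended: `𝕍` the incoherent
space of `V`, `G = U(V)(𝔸_f)`, `μ` a weight-one conjugate-symplectic character with CM type in the Galois orbit of the INVERSE type
`Φ^{*ι₁}` — [Liu2021] Def. 4.5 (2), tree `Liu2021.LiuCMData.cmType_eq_induced_of_det45`; which `μ` feeds `Φ` is part of the match
binder's content, no equation on `Φ_μ` is imposed) and, ONLY UNDER THE FACE GUARDS `IsGalois ℚ F → 6 ≤ finrank ℚ F → ι₁ ∈ Φ`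
(RULING «AS-PRINTED JUNCTION T1», pub-hodgecm2 lead gen 6, 2026-08-21T14:47Z: unguarded, the family is refuted at `ℚ(ζ₄)` with the
isotropic form, where `U_rec` realises `ℙ²` — htheta-x2 g2 `X2S2T1.junction_hypotheses_inconsistent`):
* `hLiu`   — THE CITE BINDER: Thm. 4.18 exactly as printed for that datum (`Liu2021.Thm418AsPrinted`, p277833);
* `hObj`   — `𝒜(μ)` has an object ([Liu2021] Prop. 4.6 (1), `FJcycle.tex` l. 1969 — printed in the paper, NOT part of Thm. 4.18);
* `hChi`   — an automorphic character `χ` of `E¹\(𝔸_E^∞)¹` exists (the trivial one; carrier `Chi` of Def. 4.11, l. 2090);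
* `hω`     — each `ω(μ,ε,χ)` has a non-zero vector fixed by an open compact subgroup ([Liu2021] Def. 4.11 «irreducible admissible»,
             l. 2094–2096, with App. D Lem. D.1 (1), l. 5226–5229 — printed in the paper, NOT part of Thm. 4.18; carrier-level here);
* `hMatch` — THE OBJECT MATCH (ITEM6-SPLIT §5 U1–U3; `transposition/item-6/p1/S2-ASPRINTED-CHAIN.md` C0/C6a/C6b*): a non-zero element
             of `Hom_E(A_K, A_μ)_ℚ` at an open compact `K` yields, on SOME compact Picard modular surface `P_Γ(V)` of the tree's `V`-tower
             (a component of `Sh(𝕍)_K ⊗_{E,ι₁} ℂ`, Albanese compatible) and through a common simple factor of `A_μ ⊗_{E,ι₁} ℂ` and the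
             realised `A_{(F,Φ)}`, a non-zero homomorphism `Alb(P_Γ) → A_{(F,Φ)}`.  NOT a printed hypothesis; NOT a tree theorem.
Then B01-S `U.FaceSupply`.  Kernel inside: the `μ`-admissible `ε` EXISTS and Thm. 4.18 (main) + (1) give `Hom_E(A_K, A_μ)_ℚ ≠ 0` at some
open compact `K` (item6-p3's `Liu2021.Thm418Data.exists_level_homK_ne_zero` over `Liu2021.exists_isAdmissibleElement_of_cmType` and free
base change); `hMatch` turns it into Albanese reach; `faceSupply_of_albaneseFactor` (`Transposition/Item6SupplyReach.lean`, p278665)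
closes.  STRENGTH/CONSISTENCY: §2 below — the guarded binder family is inhabited by SOME `D` iff B01-S holds (so it is consistent exactly
when B01-S is, and no stronger than B01-S with `D` free).  HC_CM is NOT proved; nothing here discharges `hMatch`. [cite: Liu2021, Thm. 4.18] -/
theorem faceSupply_of_thm418AsPrinted
    (hHD : exists_isReal_hodgeModel) (hI : hodgePQ_independent_of_hodgeModel)
    (h₁ : BallQuotientUniformised) (h₃ : CMAbelianVarietyRealised)
    (D : ∀ (F : CMField) (ι₁ : F →+* ℂ) (_ : HermSpace3 F ι₁) (_ : CMType F), Thm418Data (maximalRealSubfield F) F)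
    (hLiu : ∀ (F : CMField), IsGalois ℚ F → 6 ≤ Module.finrank ℚ F → ∀ (Φ : CMType F) (ι₁ : F →+* ℂ), ι₁ ∈ Φ.1 →
      ∀ V : HermSpace3 F ι₁, Thm418AsPrinted (D F ι₁ V Φ))
    (hObj : ∀ (F : CMField), IsGalois ℚ F → 6 ≤ Module.finrank ℚ F → ∀ (Φ : CMType F) (ι₁ : F →+* ℂ), ι₁ ∈ Φ.1 →
      ∀ V : HermSpace3 F ι₁, Nonempty (D F ι₁ V Φ).Obj)
    (hChi : ∀ (F : CMField), IsGalois ℚ F → 6 ≤ Module.finrank ℚ F → ∀ (Φ : CMType F) (ι₁ : F →+* ℂ), ι₁ ∈ Φ.1 →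
      ∀ V : HermSpace3 F ι₁, Nonempty (D F ι₁ V Φ).Chi)
    (hω : ∀ (F : CMField), IsGalois ℚ F → 6 ≤ Module.finrank ℚ F → ∀ (Φ : CMType F) (ι₁ : F →+* ℂ), ι₁ ∈ Φ.1 →
      ∀ (V : HermSpace3 F ι₁) (i : (D F ι₁ V Φ).AdmIndex),
        ∃ K₁ : Subgroup (D F ι₁ V Φ).G, IsOpenCompact K₁ ∧
          ∃ v : (D F ι₁ V Φ).omegaAt i, v ≠ 0 ∧ ∀ k ∈ K₁, (D F ι₁ V Φ).rhoAt i k v = v)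
    (hMatch : ∀ (F : CMField), IsGalois ℚ F → 6 ≤ Module.finrank ℚ F → ∀ (Φ : CMType F) (ι₁ : F →+* ℂ), ι₁ ∈ Φ.1 →
      ∀ (V : HermSpace3 F ι₁) (K : Subgroup (D F ι₁ V Φ).G) (Dμ : (D F ι₁ V Φ).Obj) (φ : (D F ι₁ V Φ).HomK K Dμ),
        IsOpenCompact K → φ ≠ 0 →
          ∃ (Γ : Level V) (𝒥 : Jacobian (Var.scheme (ballQuotientUniformisedDatum_of h₁) h₃ (.pms (pmsCode F ι₁ V Γ))))
            (u : 𝒥.J ⟶ (cmRealisation h₃ (cmCode F Φ)).AV), u ≠ 0) :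
    (picardCMUniverse hHD hI h₁ h₃).FaceSupply := by
  refine faceSupply_of_albaneseFactor hHD hI h₁ h₃ fun F hG h6 Φ ι₁ hι V => ?_
  obtain ⟨χ⟩ := hChi F hG h6 Φ ι₁ hι V
  obtain ⟨Dμ⟩ := hObj F hG h6 Φ ι₁ hι V
  obtain ⟨K, hK, φ, hφ⟩ :=
    Thm418Data.exists_level_homK_ne_zero (hLiu F hG h6 Φ ι₁ hι V) Dμ χ (hω F hG h6 Φ ι₁ hι V)
  exact hMatch F hG h6 Φ ι₁ hι V K Dμ φ hK hφ

/-- **(S2-∃) FROM [Liu2021, Thm. 4.18] AS PRINTED** — the supply clause of item (vi) in the ∃ι₁ ∃V form the day-1 assembly consumes,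
from the same face-guarded binders (`faceSupply_of_thm418AsPrinted` ∘ `exists_supplyWitness_of_faceSupply`).  HC_CM is NOT proved.
[cite: Liu2021, Thm. 4.18] -/
theorem exists_supplyWitness_of_thm418AsPrinted
    (hHD : exists_isReal_hodgeModel) (hI : hodgePQ_independent_of_hodgeModel)
    (h₁ : BallQuotientUniformised) (h₃ : CMAbelianVarietyRealised)
    (D : ∀ (F : CMField) (ι₁ : F →+* ℂ) (_ : HermSpace3 F ι₁) (_ : CMType F), Thm418Data (maximalRealSubfield F) F)
    (hLiu : ∀ (F : CMField), IsGalois ℚ F → 6 ≤ Module.finrank ℚ F → ∀ (Φ : CMType F) (ι₁ : F →+* ℂ), ι₁ ∈ Φ.1 →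
      ∀ V : HermSpace3 F ι₁, Thm418AsPrinted (D F ι₁ V Φ))
    (hObj : ∀ (F : CMField), IsGalois ℚ F → 6 ≤ Module.finrank ℚ F → ∀ (Φ : CMType F) (ι₁ : F →+* ℂ), ι₁ ∈ Φ.1 →
      ∀ V : HermSpace3 F ι₁, Nonempty (D F ι₁ V Φ).Obj)
    (hChi : ∀ (F : CMField), IsGalois ℚ F → 6 ≤ Module.finrank ℚ F → ∀ (Φ : CMType F) (ι₁ : F →+* ℂ), ι₁ ∈ Φ.1 →
      ∀ V : HermSpace3 F ι₁, Nonempty (D F ι₁ V Φ).Chi)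
    (hω : ∀ (F : CMField), IsGalois ℚ F → 6 ≤ Module.finrank ℚ F → ∀ (Φ : CMType F) (ι₁ : F →+* ℂ), ι₁ ∈ Φ.1 →
      ∀ (V : HermSpace3 F ι₁) (i : (D F ι₁ V Φ).AdmIndex),
        ∃ K₁ : Subgroup (D F ι₁ V Φ).G, IsOpenCompact K₁ ∧
          ∃ v : (D F ι₁ V Φ).omegaAt i, v ≠ 0 ∧ ∀ k ∈ K₁, (D F ι₁ V Φ).rhoAt i k v = v)
    (hMatch : ∀ (F : CMField), IsGalois ℚ F → 6 ≤ Module.finrank ℚ F → ∀ (Φ : CMType F) (ι₁ : F →+* ℂ), ι₁ ∈ Φ.1 →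
      ∀ (V : HermSpace3 F ι₁) (K : Subgroup (D F ι₁ V Φ).G) (Dμ : (D F ι₁ V Φ).Obj) (φ : (D F ι₁ V Φ).HomK K Dμ),
        IsOpenCompact K → φ ≠ 0 →
          ∃ (Γ : Level V) (𝒥 : Jacobian (Var.scheme (ballQuotientUniformisedDatum_of h₁) h₃ (.pms (pmsCode F ι₁ V Γ))))
            (u : 𝒥.J ⟶ (cmRealisation h₃ (cmCode F Φ)).AV), u ≠ 0) :
    ∀ (F : CMField), IsGalois ℚ F → 6 ≤ Module.finrank ℚ F → ∀ f : Face F,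
      ∃ ι₁ : F →+* ℂ, f.Admissible ι₁ ∧ ∃ (V : HermSpace3 F ι₁) (Γ : Level V)
        (ω₀ ω₁ : (picardCMUniverse hHD hI h₁ h₃).CohC ((picardCMUniverse hHD hI h₁ h₃).pms F ι₁ V Γ) 1),
        ω₀ ∈ (picardCMUniverse hHD hI h₁ h₃).Uiso Γ F (f.psi 0) ι₁ ∧
          ω₁ ∈ (picardCMUniverse hHD hI h₁ h₃).Uiso Γ F (f.psi 1) ι₁ ∧ ω₀ ≠ 0 ∧ ω₁ ≠ 0 :=
  exists_supplyWitness_of_faceSupply hHD hI h₁ h₃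
    (faceSupply_of_thm418AsPrinted hHD hI h₁ h₃ D hLiu hObj hChi hω hMatch)

/-! ## §2  Strength and consistency of the binder family (RULING «AS-PRINTED JUNCTION T1» (b); coordinator ruling T5) -/

/-- **B01-S gives the object match back, for EVERY datum** (the converse of the socket, no witness needed): under the face guards,
`U.FaceSupply` yields for every CM type `Φ ∋ ι₁` and every `V` a level `Γ`, an Albanese datum and a non-zero `Alb(P_Γ) → A_{(F,Φ)}`
(`faceSupply_iff_typewise`, row D0 `picardCMUniverse_Uiso_ne_bot_iff_exists_hom_ne_zero`, `nonempty_jacobian_of_isSmoothProjective_complex_of_dim`).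
Hence `hMatch` — whose conclusion does not mention its premises — follows from B01-S. [folklore] -/
theorem exists_albaneseHom_ne_zero_of_faceSupply
    (hHD : exists_isReal_hodgeModel) (hI : hodgePQ_independent_of_hodgeModel)
    (h₁ : BallQuotientUniformised) (h₃ : CMAbelianVarietyRealised) (hS : (picardCMUniverse hHD hI h₁ h₃).FaceSupply) :
    ∀ (F : CMField), IsGalois ℚ F → 6 ≤ Module.finrank ℚ F → ∀ (Φ : CMType F) (ι₁ : F →+* ℂ), ι₁ ∈ Φ.1 →
      ∀ V : HermSpace3 F ι₁,
        ∃ (Γ : Level V) (𝒥 : Jacobian (Var.scheme (ballQuotientUniformisedDatum_of h₁) h₃ (.pms (pmsCode F ι₁ V Γ))))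
          (u : 𝒥.J ⟶ (cmRealisation h₃ (cmCode F Φ)).AV), u ≠ 0 := by
  intro F hG h6 Φ ι₁ hι V
  obtain ⟨Γ, ω, hω, hω0⟩ := (faceSupply_iff_typewise hHD hI h₁ h₃).1 hS F hG h6 Φ ι₁ hι V
  have hX := Var.isSmoothProjective (ballQuotientUniformisedDatum_of h₁) h₃ (.pms (pmsCode F ι₁ V Γ))
  obtain ⟨𝒥⟩ := nonempty_jacobian_of_isSmoothProjective_complex_of_dim _ hX
  have hne : (picardCMUniverse hHD hI h₁ h₃).Uiso Γ F Φ ι₁ ≠ ⊥ := by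
    intro h0
    rw [h0, Submodule.mem_bot] at hω
    exact hω0 hω
  obtain ⟨u, hu⟩ := (picardCMUniverse_Uiso_ne_bot_iff_exists_hom_ne_zero Γ F Φ hι 𝒥).1 hne
  exact ⟨Γ, 𝒥, u, hu⟩

/-- **STRENGTH AND CONSISTENCY CERTIFICATE of the junction's binder family** (RULING «AS-PRINTED JUNCTION T1» (b); coordinator ruling
2026-08-21T15:33:56Z (3), T5).  With the datum family `D` FREE, «some `D` satisfies all five face-guarded binders `hLiu ∧ hObj ∧ hChi ∧ hω ∧
hMatch`» is EQUIVALENT to B01-S `U.FaceSupply`: (→) is `faceSupply_of_thm418AsPrinted`; (←) takes item6-p3's SCALAR DATUM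
(`Liu2021.Thm418Data.scalarDatum_consistent`: at every CM extension a datum at which Thm. 4.18 as printed, `𝒜(μ) ≠ ∅`, `Chi ≠ ∅` and the
smooth non-vanishing of the `ω`'s all HOLD — Liu-side binders jointly inhabited in the kernel) and gets `hMatch` from B01-S by
`exists_albaneseHom_ne_zero_of_faceSupply`.  READING: the binder family is consistent iff B01-S is (no contradiction is derivable from it unless B01-S is
refutable), and with `D` free the cite binder is IDLE — the junction certifies SCOPE (every printed hypothesis met at every face), not SUPPLY;
supply is the object match `hMatch` = B01-S until `D` is PINNED to Liu's theta data (ITEM6-SPLIT (vi-0)). [folklore] -/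
theorem exists_thm418Binders_iff_faceSupply
    (hHD : exists_isReal_hodgeModel) (hI : hodgePQ_independent_of_hodgeModel)
    (h₁ : BallQuotientUniformised) (h₃ : CMAbelianVarietyRealised) :
    (∃ D : ∀ (F : CMField) (ι₁ : F →+* ℂ) (_ : HermSpace3 F ι₁) (_ : CMType F), Thm418Data (maximalRealSubfield F) F,
      (∀ (F : CMField), IsGalois ℚ F → 6 ≤ Module.finrank ℚ F → ∀ (Φ : CMType F) (ι₁ : F →+* ℂ), ι₁ ∈ Φ.1 →
        ∀ V : HermSpace3 F ι₁, Thm418AsPrinted (D F ι₁ V Φ)) ∧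
      (∀ (F : CMField), IsGalois ℚ F → 6 ≤ Module.finrank ℚ F → ∀ (Φ : CMType F) (ι₁ : F →+* ℂ), ι₁ ∈ Φ.1 →
        ∀ V : HermSpace3 F ι₁, Nonempty (D F ι₁ V Φ).Obj) ∧
      (∀ (F : CMField), IsGalois ℚ F → 6 ≤ Module.finrank ℚ F → ∀ (Φ : CMType F) (ι₁ : F →+* ℂ), ι₁ ∈ Φ.1 →
        ∀ V : HermSpace3 F ι₁, Nonempty (D F ι₁ V Φ).Chi) ∧
      (∀ (F : CMField), IsGalois ℚ F → 6 ≤ Module.finrank ℚ F → ∀ (Φ : CMType F) (ι₁ : F →+* ℂ), ι₁ ∈ Φ.1 →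
        ∀ (V : HermSpace3 F ι₁) (i : (D F ι₁ V Φ).AdmIndex),
          ∃ K₁ : Subgroup (D F ι₁ V Φ).G, IsOpenCompact K₁ ∧
            ∃ v : (D F ι₁ V Φ).omegaAt i, v ≠ 0 ∧ ∀ k ∈ K₁, (D F ι₁ V Φ).rhoAt i k v = v) ∧
      (∀ (F : CMField), IsGalois ℚ F → 6 ≤ Module.finrank ℚ F → ∀ (Φ : CMType F) (ι₁ : F →+* ℂ), ι₁ ∈ Φ.1 →
        ∀ (V : HermSpace3 F ι₁) (K : Subgroup (D F ι₁ V Φ).G) (Dμ : (D F ι₁ V Φ).Obj) (φ : (D F ι₁ V Φ).HomK K Dμ),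
          IsOpenCompact K → φ ≠ 0 →
            ∃ (Γ : Level V) (𝒥 : Jacobian (Var.scheme (ballQuotientUniformisedDatum_of h₁) h₃ (.pms (pmsCode F ι₁ V Γ))))
              (u : 𝒥.J ⟶ (cmRealisation h₃ (cmCode F Φ)).AV), u ≠ 0)) ↔
    (picardCMUniverse hHD hI h₁ h₃).FaceSupply := by
  constructor
  · rintro ⟨D, hLiu, hObj, hChi, hω, hMatch⟩
    exact faceSupply_of_thm418AsPrinted hHD hI h₁ h₃ D hLiu hObj hChi hω hMatch
  · intro hS
    -- the scalar datum at every `(F, ι₁, V, Φ)` (item6-p3, `Liu2021/Thm418Invariants.lean`)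
    have hsc := fun (F : CMField) =>
      Thm418Data.scalarDatum_consistent (maximalRealSubfield F) F
    refine ⟨fun F _ _ _ => (hsc F).choose, ?_, ?_, ?_, ?_, ?_⟩
    · exact fun F _ _ Φ ι₁ _ V => (hsc F).choose_spec.1
    · exact fun F _ _ Φ ι₁ _ V => (hsc F).choose_spec.2.1
    · exact fun F _ _ Φ ι₁ _ V => (hsc F).choose_spec.2.2.1
    · exact fun F _ _ Φ ι₁ _ V i => (hsc F).choose_spec.2.2.2 i
    · exact fun F hG h6 Φ ι₁ hι V _ _ _ _ _ => exists_albaneseHom_ne_zero_of_faceSupply hHD hI h₁ h₃ hS F hG h6 Φ ι₁ hι V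

/-! ## §3  The universe OF RECORD (all four model data are tree theorems) -/

/-- **On the universe of record**: B01-S `U_rec.FaceSupply` from Thm. 4.18 as printed plus the face-guarded `hObj`/`hChi`/`hω`/`hMatch`.
HC_CM is NOT proved. [cite: Liu2021, Thm. 4.18] -/
theorem faceSupply_closed_of_thm418AsPrinted
    (D : ∀ (F : CMField) (ι₁ : F →+* ℂ) (_ : HermSpace3 F ι₁) (_ : CMType F), Thm418Data (maximalRealSubfield F) F)
    (hLiu : ∀ (F : CMField), IsGalois ℚ F → 6 ≤ Module.finrank ℚ F → ∀ (Φ : CMType F) (ι₁ : F →+* ℂ), ι₁ ∈ Φ.1 →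
      ∀ V : HermSpace3 F ι₁, Thm418AsPrinted (D F ι₁ V Φ))
    (hObj : ∀ (F : CMField), IsGalois ℚ F → 6 ≤ Module.finrank ℚ F → ∀ (Φ : CMType F) (ι₁ : F →+* ℂ), ι₁ ∈ Φ.1 →
      ∀ V : HermSpace3 F ι₁, Nonempty (D F ι₁ V Φ).Obj)
    (hChi : ∀ (F : CMField), IsGalois ℚ F → 6 ≤ Module.finrank ℚ F → ∀ (Φ : CMType F) (ι₁ : F →+* ℂ), ι₁ ∈ Φ.1 →
      ∀ V : HermSpace3 F ι₁, Nonempty (D F ι₁ V Φ).Chi)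
    (hω : ∀ (F : CMField), IsGalois ℚ F → 6 ≤ Module.finrank ℚ F → ∀ (Φ : CMType F) (ι₁ : F →+* ℂ), ι₁ ∈ Φ.1 →
      ∀ (V : HermSpace3 F ι₁) (i : (D F ι₁ V Φ).AdmIndex),
        ∃ K₁ : Subgroup (D F ι₁ V Φ).G, IsOpenCompact K₁ ∧
          ∃ v : (D F ι₁ V Φ).omegaAt i, v ≠ 0 ∧ ∀ k ∈ K₁, (D F ι₁ V Φ).rhoAt i k v = v)
    (hMatch : ∀ (F : CMField), IsGalois ℚ F → 6 ≤ Module.finrank ℚ F → ∀ (Φ : CMType F) (ι₁ : F →+* ℂ), ι₁ ∈ Φ.1 →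
      ∀ (V : HermSpace3 F ι₁) (K : Subgroup (D F ι₁ V Φ).G) (Dμ : (D F ι₁ V Φ).Obj) (φ : (D F ι₁ V Φ).HomK K Dμ),
        IsOpenCompact K → φ ≠ 0 →
          ∃ (Γ : Level V) (𝒥 : Jacobian (Var.scheme (ballQuotientUniformisedDatum_of BallQuotient.ballQuotientUniformised_holds)
              cmAbelianVarietyRealised_holds (.pms (pmsCode F ι₁ V Γ))))
            (u : 𝒥.J ⟶ (cmRealisation cmAbelianVarietyRealised_holds (cmCode F Φ)).AV), u ≠ 0) :
    (picardCMUniverse exists_isReal_hodgeModel_holds hodgePQ_independent_of_hodgeModel_holds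
      BallQuotient.ballQuotientUniformised_holds cmAbelianVarietyRealised_holds).FaceSupply :=
  faceSupply_of_thm418AsPrinted _ _ _ _ D hLiu hObj hChi hω hMatch

end Summit.HodgeConjecture.CorCM.Model

end
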